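import Summits.AtomisticToContinuum.HydrodynamicLimit.Theorems.RelayRaceLocalityLightConeInLawSketchLine
import Summits.AtomisticToContinuum.HydrodynamicLimit.Theorems.DensityCap.Negative.EosIdeal

/-!
# Two NECESSARY special cases of the crux `LightConeInLaw` (stmt-AtomisticToContinuum-12500)
(line `Sketch`, `--supports`; route `RelayRaceLocality`, sub-problem `HydrodynamicLimit`)

Negative-side bookkeeping for the crux (what every proof of it must contain, and what a numerical or
analytic refutation may target instead of the full two-copy statement):

* `oneFamily_of_lightConeInLaw` — the ONE-FAMILY LIGHT CONE IN LAW: the crux with the comparison gas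
  taken in the conjunct's own family (`σ₂ = σ₁`, `n₂ N = N + 1`, the same flows): two local Gibbs
  profiles of the SAME hard-sphere system whose `t = 0` Euler data agree on `B(x₀, R)` give merging
  laws of the reduced empirical fields tested inside `B(x₀, R − c t)` at time `t`. This is the pure
  LOCALITY content of the crux (no particle-number or diameter change).
* `particleNumberContinuity_of_lightConeInLaw` — PARTICLE-NUMBER CONTINUITY (the card's residual
  (S2) in global form; first proved by the crux ideator in its evidence file `Sketch.lean`, here
  landed in the tree): the crux with identical profiles and Euler data for both gases, `σ₂ = σ₁`,
  and a comparison particle number `n₂ N` with `n₂ N · ε_N³ → σ³` (i.e. `n₂ N = (N+1)(1+o(1))`):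
  the laws of the reduced fields at time `t` of the `(N+1)`- and the `n₂ N`-sphere gas merge, for
  EVERY continuous `χ` (no cone: with `R := c t + 1` the support clause is void because the flat
  torus has minimal-image diameter `√3/2 < 1`, tree lemma `DensityCapNegative.euclidDist_lt_one`).
  This is the pure NON-LOCAL
  residual of the crux; an MD test refuting it refutes the crux.

Both are instantiations of the route decl `RelayRaceLocality.LightConeInLaw` (no new statement is
asserted; the conclusions are written out explicitly).
-/

namespace Summit.AtomisticToContinuum.HydrodynamicLimit.Theorems.LightConeInLawSketch.Necessary

open scoped BigOperators Topology Classical ENNReal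
open Filter Set MeasureTheory
open Literature.MathematicalPhysics.KineticTheory Literature.Analysis.FluidPDE

noncomputable section

/-- **One-family light cone in law** (necessary special case of the crux: `σ₂ = σ₁ = σ`,
`n₂ N = N + 1`, `Φ₂ = Φ₁ = Φ`; the comparison law is then `localGibbsLaw σ a₂ u₂ θ₂ N (Φ N)`
definitionally and `(N+1) · hsDiameter σ N ^ 3 = σ³` identically). -/
theorem oneFamily_of_lightConeInLaw :
    Summit.AtomisticToContinuum.HydrodynamicLimit.Theses.RelayRaceLocality.LightConeInLaw →
    ∃ η₀ : ℝ, 0 < η₀ ∧ ∀ M : ℝ, 0 < M → ∃ c : ℝ, 0 < c ∧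
    ∀ (a₁ θ₁ a₂ θ₂ : T3 → ℝ) (u₁ u₂ : T3 → V3), Continuous a₁ → Continuous θ₁ → Continuous u₁ →
      Continuous a₂ → Continuous θ₂ → Continuous u₂ → (∀ x, 0 < a₁ x) → (∀ x, 0 < θ₁ x) →
      (∀ x, 0 < a₂ x) → (∀ x, 0 < θ₂ x) →
    ∃ σ₀ : ℝ, 0 < σ₀ ∧ ∀ σ : ℝ, 0 < σ → σ < σ₀ →
    ∀ (T₁ T₂ : ℝ) (ρ₁ Θ₁ ρ₂ Θ₂ : ℝ → T3 → ℝ) (U₁ U₂ : ℝ → T3 → V3),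
      IsHardSphereEulerSolution σ T₁ ρ₁ U₁ Θ₁ → IsHardSphereEulerSolution σ T₂ ρ₂ U₂ Θ₂ →
    ∀ Φ : (N : ℕ) → HardSphereFlow G3 (hsDiameter σ N) (N + 1),
    (∀ N, IsProbabilityMeasure (localGibbsLaw σ a₁ u₁ θ₁ N (Φ N))) →
    (∀ N, IsProbabilityMeasure (localGibbsLaw σ a₂ u₂ θ₂ N (Φ N))) →
    TendstoHydroFieldsAt (fun N => localGibbsLaw σ a₁ u₁ θ₁ N (Φ N)) Φ ρ₁ U₁ Θ₁ 0 →
    TendstoHydroFieldsAt (fun N => localGibbsLaw σ a₂ u₂ θ₂ N (Φ N)) Φ ρ₂ U₂ Θ₂ 0 →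
    ∀ t : ℝ, 0 ≤ t → t < T₁ → t < T₂ →
      (∀ s ∈ Set.Icc 0 t, ∀ x, ρ₁ s x * σ ^ 3 < η₀ ∧ Θ₁ s x ≤ M ∧ ‖U₁ s x‖ ≤ M ∧
        ρ₂ s x * σ ^ 3 < η₀ ∧ Θ₂ s x ≤ M ∧ ‖U₂ s x‖ ≤ M) →
    ∀ (x₀ : T3) (R : ℝ),
      (∀ x, Torus.euclidDist x x₀ < R → ρ₁ 0 x = ρ₂ 0 x ∧ U₁ 0 x = U₂ 0 x ∧ Θ₁ 0 x = Θ₂ 0 x) →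
    ∀ χ : T3 → ℝ, Continuous χ → (∀ x, R - c * t ≤ Torus.euclidDist x x₀ → χ x = 0) →
    ∀ F : ℝ × V3 × ℝ → ℝ, LipschitzWith 1 F → (∀ p, |F p| ≤ 1) →
      Tendsto (fun N =>
        (∫ z, F (σ ^ 3 * empiricalDensityField ((Φ N).flow t z) χ,
            (σ ^ 3) • empiricalMomentumField ((Φ N).flow t z) χ,
            σ ^ 3 * empiricalEnergyField ((Φ N).flow t z) χ) ∂(localGibbsLaw σ a₁ u₁ θ₁ N (Φ N))) -
        ∫ z, F (σ ^ 3 * empiricalDensityField ((Φ N).flow t z) χ,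
            (σ ^ 3) • empiricalMomentumField ((Φ N).flow t z) χ,
            σ ^ 3 * empiricalEnergyField ((Φ N).flow t z) χ) ∂(localGibbsLaw σ a₂ u₂ θ₂ N (Φ N)))
        atTop (𝓝 0) := by
  intro h
  obtain ⟨η₀, hη₀, H⟩ := h
  refine ⟨η₀, hη₀, fun M hM => ?_⟩
  obtain ⟨c, hc, Hc⟩ := H M hM
  refine ⟨c, hc, ?_⟩
  intro a₁ θ₁ a₂ θ₂ u₁ u₂ ha₁ hθ₁ hu₁ ha₂ hθ₂ hu₂ ha₁0 hθ₁0 ha₂0 hθ₂0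
  obtain ⟨σ₀, hσ₀, Hσ⟩ := Hc a₁ θ₁ a₂ θ₂ u₁ u₂ ha₁ hθ₁ hu₁ ha₂ hθ₂ hu₂ ha₁0 hθ₁0 ha₂0 hθ₂0
  refine ⟨σ₀, hσ₀, ?_⟩
  intro σ hσ hσlt T₁ T₂ ρ₁ Θ₁ ρ₂ Θ₂ U₁ U₂ hsol₁ hsol₂ Φ hP₁ hP₂ hL₁ hL₂ t ht htT₁ htT₂ hguard x₀ R
    hagree χ hχ hsupp F hF hFb
  have hn : Tendsto (fun N : ℕ => (((N + 1 : ℕ)) : ℝ) * hsDiameter σ N ^ 3) atTop (𝓝 (σ ^ 3)) := by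
    have : (fun N : ℕ => (((N + 1 : ℕ)) : ℝ) * hsDiameter σ N ^ 3) = fun _ => σ ^ 3 :=
      funext fun N => succ_mul_hsDiameter_pow_three σ N
    rw [this]
    exact tendsto_const_nhds
  have hagree' : ∀ x, Torus.euclidDist x x₀ < R →
      ρ₁ 0 x * σ ^ 3 = ρ₂ 0 x * σ ^ 3 ∧ U₁ 0 x = U₂ 0 x ∧ Θ₁ 0 x = Θ₂ 0 x := fun x hx => by
    obtain ⟨h1, h2, h3⟩ := hagree x hx
    exact ⟨by rw [h1], h2, h3⟩
  exact Hσ σ σ hσ hσlt hσ hσlt (fun N => N + 1) hn T₁ T₂ ρ₁ Θ₁ ρ₂ Θ₂ U₁ U₂ hsol₁ hsol₂ Φ Φ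
    hP₁ hP₂ hL₁ hL₂ t ht htT₁ htT₂ hguard x₀ R hagree' χ hχ hsupp F hF hFb

/-- **Particle-number continuity** (necessary special case of the crux: identical profiles and
Euler data for both gases, `σ₂ = σ₁ = σ`, comparison number `n₂ N` with `n₂ N · ε_N³ → σ³`; for every
continuous `χ` — the cone clause is void with `R := c t + 1` by `DensityCapNegative.euclidDist_lt_one`). -/
theorem particleNumberContinuity_of_lightConeInLaw :
    Summit.AtomisticToContinuum.HydrodynamicLimit.Theses.RelayRaceLocality.LightConeInLaw →
    ∃ η₀ : ℝ, 0 < η₀ ∧ ∀ M : ℝ, 0 < M →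
    ∀ (a θ : T3 → ℝ) (u : T3 → V3), Continuous a → Continuous θ → Continuous u →
      (∀ x, 0 < a x) → (∀ x, 0 < θ x) →
    ∃ σ₀ : ℝ, 0 < σ₀ ∧ ∀ σ : ℝ, 0 < σ → σ < σ₀ →
    ∀ n₂ : ℕ → ℕ, Tendsto (fun N => (n₂ N : ℝ) * hsDiameter σ N ^ 3) atTop (𝓝 (σ ^ 3)) →
    ∀ (T : ℝ) (ρ Θ : ℝ → T3 → ℝ) (U : ℝ → T3 → V3), IsHardSphereEulerSolution σ T ρ U Θ →
    ∀ (Φ₁ : (N : ℕ) → HardSphereFlow G3 (hsDiameter σ N) (N + 1))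
      (Φ₂ : (N : ℕ) → HardSphereFlow G3 (hsDiameter σ N) (n₂ N)),
    (∀ N, IsProbabilityMeasure (localGibbsLaw σ a u θ N (Φ₁ N))) →
    (∀ N, IsProbabilityMeasure (particleLaw (Φ₂ N)
      (canonicalDensity G3 (hsDiameter σ N) (n₂ N) (localGibbsProfile a u θ)))) →
    TendstoHydroFieldsAt (fun N => localGibbsLaw σ a u θ N (Φ₁ N)) Φ₁ ρ U Θ 0 →
    LLNAt n₂ (fun N => particleLaw (Φ₂ N)
      (canonicalDensity G3 (hsDiameter σ N) (n₂ N) (localGibbsProfile a u θ))) Φ₂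
      (ρ 0) (U 0) (Θ 0) 0 →
    ∀ t : ℝ, 0 ≤ t → t < T →
      (∀ s ∈ Set.Icc 0 t, ∀ x, ρ s x * σ ^ 3 < η₀ ∧ Θ s x ≤ M ∧ ‖U s x‖ ≤ M) →
    ∀ χ : T3 → ℝ, Continuous χ →
    ∀ F : ℝ × V3 × ℝ → ℝ, LipschitzWith 1 F → (∀ p, |F p| ≤ 1) →
      Tendsto (fun N =>
        (∫ z, F (σ ^ 3 * empiricalDensityField ((Φ₁ N).flow t z) χ,
            (σ ^ 3) • empiricalMomentumField ((Φ₁ N).flow t z) χ,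
            σ ^ 3 * empiricalEnergyField ((Φ₁ N).flow t z) χ) ∂(localGibbsLaw σ a u θ N (Φ₁ N))) -
        ∫ z, F (σ ^ 3 * empiricalDensityField ((Φ₂ N).flow t z) χ,
            (σ ^ 3) • empiricalMomentumField ((Φ₂ N).flow t z) χ,
            σ ^ 3 * empiricalEnergyField ((Φ₂ N).flow t z) χ) ∂(particleLaw (Φ₂ N)
              (canonicalDensity G3 (hsDiameter σ N) (n₂ N) (localGibbsProfile a u θ))))
        atTop (𝓝 0) := by
  intro h
  obtain ⟨η₀, hη₀, H⟩ := h
  refine ⟨η₀, hη₀, fun M hM => ?_⟩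
  obtain ⟨c, _hc, Hc⟩ := H M hM
  intro a θ u ha hθ hu ha0 hθ0
  obtain ⟨σ₀, hσ₀, Hσ⟩ := Hc a θ a θ u u ha hθ hu ha hθ hu ha0 hθ0 ha0 hθ0
  refine ⟨σ₀, hσ₀, ?_⟩
  intro σ hσ hσlt n₂ hn T ρ Θ U hsol Φ₁ Φ₂ hP₁ hP₂ hL₁ hL₂ t ht htT hguard χ hχ F hF hFb
  have hguard' : ∀ s ∈ Set.Icc 0 t, ∀ x, ρ s x * σ ^ 3 < η₀ ∧ Θ s x ≤ M ∧ ‖U s x‖ ≤ M ∧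
      ρ s x * σ ^ 3 < η₀ ∧ Θ s x ≤ M ∧ ‖U s x‖ ≤ M := fun s hs x =>
    ⟨(hguard s hs x).1, (hguard s hs x).2.1, (hguard s hs x).2.2,
      (hguard s hs x).1, (hguard s hs x).2.1, (hguard s hs x).2.2⟩
  have hagree : ∀ x, Torus.euclidDist x (0 : T3) < c * t + 1 →
      ρ 0 x * σ ^ 3 = ρ 0 x * σ ^ 3 ∧ U 0 x = U 0 x ∧ Θ 0 x = Θ 0 x := fun _ _ => ⟨rfl, rfl, rfl⟩
  have hsupp : ∀ x, c * t + 1 - c * t ≤ Torus.euclidDist x (0 : T3) → χ x = 0 := fun x hx => by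
    have h1 := DensityCapNegative.euclidDist_lt_one x (0 : T3)
    exact absurd hx (by linarith)
  exact Hσ σ σ hσ hσlt hσ hσlt n₂ hn T T ρ Θ ρ Θ U U hsol hsol Φ₁ Φ₂ hP₁ hP₂ hL₁ hL₂ t ht htT htT
    hguard' 0 (c * t + 1) hagree χ hχ hsupp F hF hFb

end

end Summit.AtomisticToContinuum.HydrodynamicLimit.Theorems.LightConeInLawSketch.Necessary
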